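import Summits.BirchSwinnertonDyer.BirchSwinnertonDyer.Theorems.Rank2Observatory2DescClRealRowCertLe
import Summits.BirchSwinnertonDyer.BirchSwinnertonDyer.Theorems.Rank2Observatory2DescClCurveCertE
import HarnessLib

/-!
# BirchSwinnertonDyer — rank ≥ 2 observatory: KERNEL-2DESC-CL v2.3 — per-curve soundness over a TWO-VIEW field (totally real case)

HONEST FRAMING: per-curve certified theorems and census instruments; no claim on BSD in rank ≥ 2.

The totally-real companion of `…2DescClCurveCertE`.  The v2.2 per-curve `r`-checker `checkRLe r fr ccr` (`…2DescClRealRowCertLe`) only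
READS the v2.1 real field record `fr : ClFieldCertR`; its soundness used the Minkowski sweep of `fr.core` at one point (the classes of
the primes above `q` generate `Cl(K)`).  Here that result is ABSTRACTED into a hypothesis (`rank_le_of_checkRLe_reg`) and instantiated
with the TWO-VIEW real record `ClFieldCertRE` = a v2.1 record `re` + the second generator `η = u(α)/d` (`toE : ClFieldCertE` shares the
signature-free core `checkCoreE` of `…2DescClFieldCertE`): `checkRE = re.checkArch ∧ toE.checkCoreE`, `rank_eq_of_checkRLe_RE`, row shapes
`rank_eq_of_certsRELe[_scaled|_complSq]`.  New file only; sorry-free; axioms `propext`, `Classical.choice`, `Quot.sound`.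
[cite: Cassels1991LecturesEllipticCurves, §15] [cite: CremonaAlgorithms1997, §3.6] [cite: Cohen1993, §6.2, §6.5] [cite: SilvermanAEC2009, III.3.1(b)]
-/

set_option linter.dupNamespace false

noncomputable section

open scoped Classical NumberField nonZeroDivisors

open Literature.NumberTheory.NumberFields Polynomial Module NumberField IsDedekindDomain Ideal

namespace Summit.BirchSwinnertonDyer.BirchSwinnertonDyer.Rank2Observatory.TwoDescCl

open TwoDescCubic ClFieldCert

/-! ## The archimedean clause on its own -/

namespace ClFieldCertR

variable {K : Type*} [Field K] [NumberField K] {θ : K} (fr : ClFieldCertR)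

/-- `Δ(g) > 0`. [folklore] -/
theorem disc_pos_of_arch (harch : fr.checkArch = true) : 0 < MonicCubic.disc fr.core.a fr.core.b fr.core.c := by
  simp only [checkArch, Bool.and_eq_true, decide_eq_true_eq] at harch
  exact harch.1.1.1

/-- Unit rank `2`. [cite: Marcus2018, Ch. 5, Thm. 38] -/
theorem units_rank_of_arch (hθ : aeval θ (MonicCubic.poly fr.core.a fr.core.b fr.core.c) = 0)
    (h3 : finrank ℚ K = 3) (hR : fr.core.checkReg = true) (harch : fr.checkArch = true) :
    NumberField.Units.rank K = 2 :=
  units_rank_eq_two_of_disc_pos (fr.core.irreducible_of_reg hR) hθ h3 (fr.disc_pos_of_arch harch)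

/-- The intervals start at non-negative rationals. [folklore] -/
theorem lo_nonneg_of_arch (harch : fr.checkArch = true) (k : Fin 3) : 0 ≤ (fr.I k).1 := by
  simp only [checkArch, Bool.and_eq_true, decide_eq_true_eq] at harch
  fin_cases k <;> simp only [I, Fin.isValue, Fin.zero_eta, Fin.mk_one, Fin.reduceFinMk, ↓reduceIte,
    Fin.reduceEq]
  exacts [harch.1.1.2.1, harch.1.2.1, harch.2.1]

/-- **The three real places** with `loₖ < ρₖ(α) < hiₖ`. [folklore] -/
theorem exists_rho_of_arch (hθ : aeval θ (MonicCubic.poly fr.core.a fr.core.b fr.core.c) = 0)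
    (h3 : finrank ℚ K = 3) (hR : fr.core.checkReg = true) (harch : fr.checkArch = true) :
    ∃ ρ : Fin 3 → (K →+* ℝ), ∀ k, (((fr.I k).1 : ℚ) : ℝ) < ρ k θ ∧ ρ k θ < (((fr.I k).2 : ℚ) : ℝ) := by
  have hirr := fr.core.irreducible_of_reg hR
  simp only [checkArch, Bool.and_eq_true, decide_eq_true_eq] at harch
  obtain ⟨⟨⟨-, -, hlt₀, hlo₀, hhi₀⟩, -, hlt₁, hlo₁, hhi₁⟩, -, hlt₂, hlo₂, hhi₂⟩ := harch
  obtain ⟨ρ₀, h₀⟩ := exists_real_embedding_of_sign_change hirr hθ h3 hlt₀ hlo₀ hhi₀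
  obtain ⟨ρ₁, h₁⟩ := exists_real_embedding_of_sign_change' hirr hθ h3 hlt₁ hlo₁ hhi₁
  obtain ⟨ρ₂, h₂⟩ := exists_real_embedding_of_sign_change hirr hθ h3 hlt₂ hlo₂ hhi₂
  refine ⟨fun k => if k = 0 then ρ₀ else if k = 1 then ρ₁ else ρ₂, fun k => ?_⟩
  fin_cases k <;> simp only [I, Fin.isValue, Fin.zero_eta, Fin.mk_one, Fin.reduceFinMk, ↓reduceIte,
    Fin.reduceEq]
  exacts [h₀, h₁, h₂]

end ClFieldCertR

/-! ## Soundness from the registry core and a class-group generation certificate -/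

section Sound

variable {K : Type*} [Field K] [NumberField K] {θ : K}

/-- **Soundness of the totally-real `r`-checker from the registry core, the archimedean clause and ANY
certificate that the classes of the primes above `q` generate `Cl(K)`: `rank E(ℚ) ≤ r`** (the proof of
`rank_le_of_checkRLe`, the sweep result abstracted into the hypothesis `hcl`). [cite: Cassels1991LecturesEllipticCurves, §15] -/
theorem rank_le_of_checkRLe_reg (r : ℕ) (fr : ClFieldCertR)
    (hθ : aeval θ (MonicCubic.poly fr.core.a fr.core.b fr.core.c) = 0)
    (h3 : finrank ℚ K = 3) (hR : fr.core.checkReg = true) (harch : fr.checkArch = true)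
    (hcl : Subgroup.closure {cl : ClassGroup (𝓞 K) | ∃ (J : Ideal (𝓞 K)) (hJ : J ∈ (Ideal (𝓞 K))⁰),
      ((fr.core.q : ℕ) : 𝓞 K) ∈ J ∧ ClassGroup.mk0 ⟨J, hJ⟩ = cl} = ⊤)
    (hpr : fr.core.primeList.Forall Nat.Prime) (ccr : ClCurveCertR)
    (hc : checkRLe r fr ccr = true) :
    ((⟨0, ccr.cc.A, 0, ccr.cc.B, ccr.cc.C⟩ : WeierstrassCurve ℚ)).mordellWeilRank ≤ r := by
  classical
  have hirr := fr.core.irreducible_of_reg hR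
  have hq := fr.core.q_prime hpr
  have h0 := fr.lo_nonneg_of_arch harch
  set fc := fr.core with hfc
  set cc := ccr.cc with hcc
  simp only [checkRLe, Bool.and_eq_true, decide_eq_true_eq, List.all_eq_true, List.any_eq_true,
    Bool.or_eq_true, beq_iff_eq] at hc
  obtain ⟨⟨⟨⟨⟨⟨⟨⟨⟨⟨⟨⟨⟨⟨⟨hΔ, hirrF⟩, hcub⟩, hder⟩, hdisc⟩, hND0⟩, hdn⟩, hdnC⟩, hcodes⟩, hdW1⟩, hdW2⟩, hQ⟩,
    hfamAll⟩, hord⟩, hcert⟩, hcount⟩ := hc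
  haveI hE := isElliptic_of_deltaShort_ne hΔ
  have hirrF' := irreducible_of_noRootMod hirrF
  -- `θ_E`, `D`, `M = D·q`
  have haev := aeval_lin_eq_zero_of_coords hθ cc.t hcub
  have hderiv : (3 : 𝓞 K) * (lin hθ cc.t.1 cc.t.2.1 cc.t.2.2) ^ 2 +
      2 * ((cc.A : ℤ) : 𝓞 K) * (lin hθ cc.t.1 cc.t.2.1 cc.t.2.2) + ((cc.B : ℤ) : 𝓞 K) =
        lin hθ cc.D.1 cc.D.2.1 cc.D.2.2 := by
    simpa using deriv_eq_of_coords hθ cc.t cc.D [] hder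
  have hD0 : (lin hθ cc.D.1 cc.D.2.1 cc.D.2.2 : 𝓞 K) ≠ 0 := lin_ne_zero_of_coords hirr hθ h3 _ hND0
  have hq0 : ((fc.q : ℕ) : 𝓞 K) ≠ 0 := by exact_mod_cast hq.ne_zero
  have hM0 : (lin hθ cc.D.1 cc.D.2.1 cc.D.2.2 : 𝓞 K) * ((fc.q : ℕ) : 𝓞 K) ≠ 0 := mul_ne_zero hD0 hq0
  have hgen := closure_tsupp_eq_top_of_dvd
    (dvd_mul_left ((fc.q : ℕ) : 𝓞 K) (lin hθ cc.D.1 cc.D.2.1 cc.D.2.2)) hcl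
  have hDM : ∀ v : HeightOneSpectrum (𝓞 K), (3 : 𝓞 K) * (lin hθ cc.t.1 cc.t.2.1 cc.t.2.2) ^ 2 +
      2 * ((cc.A : ℤ) : 𝓞 K) * (lin hθ cc.t.1 cc.t.2.1 cc.t.2.2) + ((cc.B : ℤ) : 𝓞 K) ∈ v.asIdeal →
      (lin hθ cc.D.1 cc.D.2.1 cc.D.2.2 : 𝓞 K) * ((fc.q : ℕ) : 𝓞 K) ∈ v.asIdeal := by
    intro v hv
    rw [hderiv] at hv
    exact Ideal.mul_mem_right _ _ hv
  have hDW₁ : (lin hθ cc.D.1 cc.D.2.1 cc.D.2.2 : 𝓞 K) ∉ (fc.W₁r hθ h3 hR hpr).asIdeal :=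
    lin_not_mem_of_invCert hθ _ (W₁r_asIdeal hθ h3 hR hpr) hdW1
  have hDW₂ : (lin hθ cc.D.1 cc.D.2.1 cc.D.2.2 : 𝓞 K) ∉ (fc.W₂r hθ h3 hR hpr).asIdeal :=
    lin_not_mem_of_invCert hθ _ (W₂r_asIdeal hθ h3 hR hpr) hdW2
  -- the support `T = {W₁, W₂} ∪ codes`
  set L := cc.codes.length with hL
  let Tf : Fin (L + 2) → HeightOneSpectrum (𝓞 K) := Matrix.vecCons (fc.W₁r hθ h3 hR hpr)
    (Matrix.vecCons (fc.W₂r hθ h3 hR hpr) fun i => codePrimeR hθ h3 hR hpr (cc.codes.get i))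
  have hT : ∀ w : HeightOneSpectrum (𝓞 K),
      (lin hθ cc.D.1 cc.D.2.1 cc.D.2.2 : 𝓞 K) * ((fc.q : ℕ) : 𝓞 K) ∈ w.asIdeal → ∃ i, Tf i = w := by
    intro w hw
    rcases w.isPrime.mem_or_mem hw with hD | hqw
    · obtain ⟨l, hl, hldvd, hlw⟩ := exists_prime_dvd_norm_mem w hD0 hD
      rw [natAbs_norm_lin_coords hirr hθ h3, hdn] at hldvd
      obtain ⟨a, ha, hla⟩ := (Prime.dvd_prod_iff hl.prime).mp hldvd
      obtain ⟨pe, hpe, rfl⟩ := List.mem_map.mp ha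
      obtain ⟨hany, hrowcodes⟩ := hdnC pe hpe
      have hany' : (fc.primes.any fun e => e.p == pe.1) = true := by simpa [List.any_eq_true] using hany
      obtain ⟨hrow, hrowp⟩ := row_mem hany'
      have hpp : (fc.row pe.1).p.Prime := fc.prime_of_mem hpr hrow
      have hl_eq : l = pe.1 :=
        (Nat.prime_dvd_prime_iff_eq hl (hrowp ▸ hpp)).mp (hl.dvd_of_dvd_pow hla)
      have hlw' : ((fc.row pe.1).p : 𝓞 K) ∈ w.asIdeal := by rw [hrowp, ← hl_eq]; exact hlw
      obtain ⟨C', hC', hw'⟩ :=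
        exists_code_of_natCast_mem hirr hθ h3 hpp (fc.row_check_of_mem_reg hR hrow).1 w hlw'
      rcases hrowcodes C' hC' with hmem | ⟨ci, -, hci, hinv⟩
      · obtain ⟨i, hi⟩ := List.mem_iff_get.mp hmem
        obtain ⟨hc1, hc2⟩ := hcodes _ (List.get_mem _ i)
        have hc1' : (fc.primes.any fun e => e.p == (cc.codes.get i).1) = true := by
          simpa [List.any_eq_true] using hc1
        refine ⟨i.succ.succ, HeightOneSpectrum.ext ?_⟩
        simp only [Tf, Matrix.cons_val_succ]
        rw [codePrimeR_asIdeal hθ h3 hR hpr hc1' hc2, hi, hw']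
      · exact absurd hD (lin_not_mem_of_invCert hθ w hw' hinv)
    · rcases eq_W₁r_or_W₂r hθ h3 hR hpr w hqw with rfl | rfl
      · exact ⟨0, by simp [Tf]⟩
      · exact ⟨1, by simp [Tf]⟩
  -- the family
  set fm := famR fr cc with hfm
  let W : Fin fm.length → 𝓞 K := fun j => lin hθ (fm.get j).2.2.g.1 (fm.get j).2.2.g.2.1 (fm.get j).2.2.g.2.2
  have hfam : ∀ j : Fin fm.length, famCheckR fr cc.D (fm.get j) = true := fun j => hfamAll _ (List.get_mem _ j)
  have hfam1 : ∀ j : Fin fm.length, famCheck fc cc.D (fm.get j) = true := fun j => famCheck_of_famCheckR (hfam j)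
  have hW0 : ∀ j, W j ≠ 0 := fun j => lin_ne_zero_of_famCheck_reg hθ h3 hR (hfam1 j)
  have hWval : ∀ j (v : HeightOneSpectrum (𝓞 K)),
      (lin hθ cc.D.1 cc.D.2.1 cc.D.2.2 : 𝓞 K) * ((fc.q : ℕ) : 𝓞 K) ∉ v.asIdeal →
        v.valuation K (algebraMap (𝓞 K) K (W j)) = 1 :=
    fun j v hv => valuation_eq_one_of_support _ _ (supp_of_famCheck_reg hθ h3 hR hpr (hfam1 j)) v hv
  obtain ⟨ρ, hρ⟩ := fr.exists_rho_of_arch hθ h3 hR harch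
  have hsg : ∀ (k : Fin 3) (j : Fin fm.length),
      (sgAt fr (fm.get j) k = true ↔ ρ k (algebraMap (𝓞 K) K (W j)) < 0) :=
    fun k j => sgAt_iff_of_famCheckR hθ ρ h0 hρ (hfam j) k
  have hρ0 : ∀ (k : Fin 3) (j : Fin fm.length), ρ k (algebraMap (𝓞 K) K (W j)) ≠ 0 :=
    fun k j => rho_ne_zero_of_famCheckR hθ ρ h0 hρ (hfam j) k
  -- independence modulo squares: the parity certificate
  have hind : ∀ S : Finset (Fin fm.length), IsSquare (∏ i ∈ S, algebraMap (𝓞 K) K (W i)) → S = ∅ := by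
    intro S hS
    refine indep_of_parity_certificate (fun i => algebraMap (𝓞 K) K (W i)) (bitR fr cc) ?_ hcert S hS
    intro k S' hS'
    have hS'' : IsSquare (∏ i ∈ S', W i) := isSquare_prod_of_isSquare_prod_coe _ hS'
    have hreal : ∀ kk : Fin 3,
        Even (S'.filter fun i => sgAt fr (fm.get i) kk = true).card := fun kk => by
      have h := even_card_of_isSquare_real (ρ kk) (fun i => algebraMap (𝓞 K) K (W i)) (fun i => hρ0 kk i) hS'
      convert h using 2
      exact Finset.filter_congr (fun i _ => hsg kk i)
    obtain ⟨k, hk⟩ := k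
    rcases k with _ | _ | _ | _ | _ | k
    · simpa [bitR, bitRowR, sgAt] using hreal 0
    · simpa [bitR, bitRowR, sgAt] using hreal 1
    · simpa [bitR, bitRowR, sgAt] using hreal 2
    · exact even_card_of_isSquare_valuation (fc.W₁r hθ h3 hR hpr) W hW0 _
        (fun i => by
          show ((!decide ((2 : ℤ) ∣ famL₁ (fm.get i))) = true ↔ _)
          rw [log_W₁r_of_famCheck hθ h3 hR hpr (hfam1 i)]; simp) hS'
    · exact even_card_of_isSquare_valuation (fc.W₂r hθ h3 hR hpr) W hW0 _
        (fun i => by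
          show ((!decide ((2 : ℤ) ∣ famL₂ (fm.get i))) = true ↔ _)
          rw [log_W₂r_of_famCheck hθ h3 hR hpr (hfam1 i)]; simp) hS'
    · have hk' : k < fc.chars.length := by rw [hfc]; omega
      have hch : fc.chars.getD k ((3 : ℕ), (0 : ℤ), (0 : ℤ)) ∈ fc.chars := by
        rw [List.getD_eq_getElem?_getD, List.getElem?_eq_getElem hk', Option.getD_some]
        exact List.getElem_mem hk'
      obtain ⟨h2, ψ, hψ⟩ := fc.exists_psi_of_reg hθ h3 hR hpr hch
      haveI : Fact (fc.chars.getD k (3, 0, 0)).1.Prime := ⟨fc.char_prime hpr hch⟩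
      have h := even_card_filter_eulerBit hθ (ℓ := (fc.chars.getD k (3, 0, 0)).1) (by omega) ψ hψ
        (fun i => (fm.get i).2.2.g) (fun i => not_dvd_evalInt_of_famCheck (hfam1 i) hch) hS''
      convert h using 2
      exact Finset.filter_congr (fun i _ => Iff.rfl)
  -- spanning of the `T`-units modulo squares
  have hodd : Odd (finrank ℚ K) := by rw [h3]; decide
  have hn : fm.length = NumberField.Units.rank K + 1 + (L + 2) := by
    rw [fr.units_rank_of_arch hθ h3 hR harch]
    simp only [hfm, famR, fam, List.length_cons, List.length_map, hL]
    omega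
  have hspan : ∀ u : K, u ≠ 0 →
      (∀ v : HeightOneSpectrum (𝓞 K),
        (lin hθ cc.D.1 cc.D.2.1 cc.D.2.2 : 𝓞 K) * ((fc.q : ℕ) : 𝓞 K) ∉ v.asIdeal → v.valuation K u = 1) →
      ∃ U : Finset (Fin fm.length), IsSquare (u * ∏ j ∈ U, algebraMap (𝓞 K) K (W j)) :=
    fun u hu huT => exists_isSquare_tunit_mul_prod hodd _ Tf hT hn (fun j => algebraMap (𝓞 K) K (W j))
      (fun j => RingOfIntegers.coe_ne_zero_iff.mpr (hW0 j)) hWval hind u hu huT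
  -- the sieve is sound at rational points
  have hθQ : ∀ x : ℚ, algebraMap ℚ K x ≠ algebraMap (𝓞 K) K (lin hθ cc.t.1 cc.t.2.1 cc.t.2.2) :=
    ne_of_powIndep (powIndep_algebraMap hirrF' haev h3)
  have hFrel : (lin hθ cc.t.1 cc.t.2.1 cc.t.2.2 : 𝓞 K) ^ 3 + cc.A * (lin hθ cc.t.1 cc.t.2.1 cc.t.2.2) ^ 2 +
      cc.B * (lin hθ cc.t.1 cc.t.2.1 cc.t.2.2) + cc.C = 0 := by
    apply RingOfIntegers.coe_injective
    simpa only [map_add, map_mul, map_pow, map_intCast, _root_.map_zero] using MonicCubic.theta_rel haev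
  -- the `θ_E`-order of the places
  have h12 : ρ ccr.o₀ ((lin hθ cc.t.1 cc.t.2.1 cc.t.2.2 : 𝓞 K) : K) <
      ρ ccr.o₁ ((lin hθ cc.t.1 cc.t.2.1 cc.t.2.2 : 𝓞 K) : K) :=
    lin_lt_lin hθ (ρ ccr.o₀) (ρ ccr.o₁) (h0 _) (hρ _).1 (hρ _).2 (h0 _) (hρ _).1 (hρ _).2 _ _ _
      (of_decide_eq_true hord.1)
  have h23 : ρ ccr.o₁ ((lin hθ cc.t.1 cc.t.2.1 cc.t.2.2 : 𝓞 K) : K) <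
      ρ ccr.o₂ ((lin hθ cc.t.1 cc.t.2.1 cc.t.2.2 : 𝓞 K) : K) :=
    lin_lt_lin hθ (ρ ccr.o₁) (ρ ccr.o₂) (h0 _) (hρ _).1 (hρ _).2 (h0 _) (hρ _).1 (hρ _).2 _ _ _
      (of_decide_eq_true hord.2)
  have hadm0 : admR fr ccr ∅ ∅ = true := by
    simp only [admR, Bool.and_eq_true, decide_eq_true_eq, Finset.filter_empty, Finset.card_empty]
    exact ⟨⟨admStd3RQ_empty _ hQ _ _ _ _ _ _ _ _, by decide⟩, by decide⟩
  have hadm : ∀ x y : ℚ, y ^ 2 = x ^ 3 + cc.A * x ^ 2 + cc.B * x + cc.C →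
      ∀ (T : Finset (Fin 0)) (U : Finset (Fin fm.length)),
        IsSquare ((algebraMap ℚ K x - algebraMap (𝓞 K) K (lin hθ cc.t.1 cc.t.2.1 cc.t.2.2)) *
          (∏ i ∈ T, algebraMap (𝓞 K) K (((fun i : Fin 0 => i.elim0 : Fin 0 → (𝓞 K)ˣ) i : (𝓞 K)ˣ) : 𝓞 K)) *
            ∏ j ∈ U, algebraMap (𝓞 K) K (W j)) → admR fr ccr T U = true := by
    intro x y hxy T U hsq
    have h1 : admStd3R (fun i : Fin 0 => i.elim0) (famNormR fr cc) (fun i : Fin 0 => i.elim0)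
        (fun i : Fin 0 => i.elim0) (fun i : Fin 0 => i.elim0) (fun j => sgAt fr (fm.get j) ccr.o₀)
        (fun j => sgAt fr (fm.get j) ccr.o₁) (fun j => sgAt fr (fm.get j) ccr.o₂) T U = true :=
      admStd3R_sound hirrF' haev h3 (ρ ccr.o₀) (ρ ccr.o₁) (ρ ccr.o₂) h12 h23
        (w := fun i : Fin 0 => algebraMap (𝓞 K) K
          (((fun i : Fin 0 => i.elim0 : Fin 0 → (𝓞 K)ˣ) i : (𝓞 K)ˣ) : 𝓞 K))
        (g := fun j => algebraMap (𝓞 K) K (W j)) (fun i => i.elim0)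
        (fun j => RingOfIntegers.coe_ne_zero_iff.mpr (hW0 j)) (fun i => i.elim0)
        (fun j => norm_of_famCheck_reg hθ h3 hR) (fun i => i.elim0) (fun i => i.elim0) (fun i => i.elim0)
        (fun j => hsg _ j) (fun j => hsg _ j) (fun j => hsg _ j) x y hxy T U hsq
    have h2 := valRow_sound hFrel hθQ (fc.W₁r hθ h3 hR hpr) (by rw [hderiv]; exact hDW₁) hW0
      (r := fun j => bitRowR fr (fm.get j) 3) (fun j => by
        show ((!decide ((2 : ℤ) ∣ famL₁ (fm.get j))) = true ↔ _)
        rw [show algebraMap (𝓞 K) K (W j) = ((W j : 𝓞 K) : K) from rfl,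
          log_W₁r_of_famCheck hθ h3 hR hpr (hfam1 j)]; simp) x y hxy T U hsq
    have h3' := valRow_sound hFrel hθQ (fc.W₂r hθ h3 hR hpr) (by rw [hderiv]; exact hDW₂) hW0
      (r := fun j => bitRowR fr (fm.get j) 4) (fun j => by
        show ((!decide ((2 : ℤ) ∣ famL₂ (fm.get j))) = true ↔ _)
        rw [show algebraMap (𝓞 K) K (W j) = ((W j : 𝓞 K) : K) from rfl,
          log_W₂r_of_famCheck hθ h3 hR hpr (hfam1 j)]; simp) x y hxy T U hsq
    simp only [admR, Bool.and_eq_true]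
    exact ⟨⟨admStd3RQ_of_admStd3R hQ h1, h2⟩, h3'⟩
  exact mordellWeilRank_le_of_coverSet_cl_lt (A := cc.A) (B := cc.B) (C := cc.C)
    (⟨0, cc.A, 0, cc.B, cc.C⟩ : WeierstrassCurve ℚ) rfl rfl rfl rfl rfl hirrF' haev h3 hM0 hgen hDM hW0 hspan
    (Wu := fun i : Fin 0 => i.elim0) (adm := admR fr ccr) hadm0 hadm (s' := r) hcount


end Sound

/-! ## The two-view field record, totally real case -/

/-- **Two-view per-field certificate, totally real**: a v2.1 real record `re` (its `core` is the `α`-view;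
the sweep clause of `core` is NOT used) plus the second generator `η = u(α)/d`, its minimal polynomial
`h = X³ + a′X² + b′X + c′`, an irreducibility modulus for `h`, and the `η`-rows. Pure data. [cite: Cohen1993, §6.2, §6.5] -/
structure ClFieldCertRE where
  /-- the v2.1 real record (`α`-view) -/
  re : ClFieldCertR
  /-- `η = (u₀ + u₁α + u₂α²)/d` -/
  u : ℤ × ℤ × ℤ
  /-- `η = (u₀ + u₁α + u₂α²)/d`, `0 < d` -/
  d : ℕ
  /-- `h = X³ + a′X² + b′X + c′`, the minimal polynomial of `η` -/
  a' : ℤ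
  /-- `h = X³ + a′X² + b′X + c′` -/
  b' : ℤ
  /-- `h = X³ + a′X² + b′X + c′` -/
  c' : ℤ
  /-- a modulus modulo which `h` has no root -/
  pIrrE : ℕ
  /-- registry rows in the `η`-view (never `q`) -/
  primesE : List PrimeEntry
  /-- two-view class certificates for the sweep (may be empty) -/
  c2 : ClsCert2

namespace ClFieldCertRE

variable (fre : ClFieldCertRE)

/-- The signature-free two-view record underneath. -/
def toE : ClFieldCertE := ⟨fre.re.core, fre.u, fre.d, fre.a', fre.b', fre.c', fre.pIrrE, fre.primesE, fre.c2⟩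

/-- **The totally-real two-view per-field checker**: archimedean clause of `re` and the two-view core.
Computable; `decide +kernel` once per field. -/
def checkRE : Bool := fre.re.checkArch && fre.toE.checkCoreE

/-- The archimedean clause of a checked two-view real record. -/
theorem checkArch_of_checkRE (hE : fre.checkRE = true) : fre.re.checkArch = true := by
  simp only [checkRE, Bool.and_eq_true] at hE; exact hE.1

/-- The two-view core clause of a checked two-view real record. -/
theorem checkCoreE_of_checkRE (hE : fre.checkRE = true) : fre.toE.checkCoreE = true := by
  simp only [checkRE, Bool.and_eq_true] at hE; exact hE.2

/-- The `α`-view base of `toE` is the v2.1 registry core (definitional). -/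
theorem toE_base : fre.toE.base = fre.re.core := rfl

end ClFieldCertRE

section SoundRE

variable {K : Type*} [Field K] [NumberField K] {θ : K}

/-- **`rank E(ℚ) = r`** (totally real two-view field) from the checked records and a tree lower bound.
[cite: CremonaAlgorithms1997, §3.6] -/
theorem rank_eq_of_checkRLe_RE (r : ℕ) (fre : ClFieldCertRE)
    (hθ : aeval θ (MonicCubic.poly fre.re.core.a fre.re.core.b fre.re.core.c) = 0) (h3 : finrank ℚ K = 3)
    (hE : fre.checkRE = true) (hpr : fre.toE.primeListE.Forall Nat.Prime) (ccr : ClCurveCertR)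
    (hc : checkRLe r fre.re ccr = true)
    (hlow : r ≤ (((⟨0, ccr.cc.A, 0, ccr.cc.B, ccr.cc.C⟩ : WeierstrassCurve ℤ)).map (Int.castRingHom ℚ)).mordellWeilRank) :
    (((⟨0, ccr.cc.A, 0, ccr.cc.B, ccr.cc.C⟩ : WeierstrassCurve ℤ)).map (Int.castRingHom ℚ)).mordellWeilRank = r := by
  have hV : ((⟨0, ccr.cc.A, 0, ccr.cc.B, ccr.cc.C⟩ : WeierstrassCurve ℤ)).map (Int.castRingHom ℚ) =
      (⟨0, ccr.cc.A, 0, ccr.cc.B, ccr.cc.C⟩ : WeierstrassCurve ℚ) := by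
    ext <;> simp [WeierstrassCurve.map]
  have hC := fre.checkCoreE_of_checkRE hE
  refine le_antisymm ?_ hlow
  rw [hV]
  exact rank_le_of_checkRLe_reg r fre.re hθ h3 (fre.toE.checkReg_of_coreE hC) (fre.checkArch_of_checkRE hE)
    (fre.toE.closure_q_eq_top_of_coreE hθ h3 hC hpr) (fre.toE.base_primeList hpr) ccr hc

end SoundRE

/-! ## `K`-free wrappers over the model `CubicField a b c` -/

/-- **`rank E(ℚ) = r` from the two records** (model `(0, A, 0, B, C)`, totally real two-view field).
[cite: Cassels1991LecturesEllipticCurves, §15] [cite: CremonaAlgorithms1997, §3.6] -/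
theorem rank_eq_of_certsRELe (r : ℕ) (fre : ClFieldCertRE) (ccr : ClCurveCertR) (hE : fre.checkRE = true)
    (hpr : fre.toE.primeListE.Forall Nat.Prime) (hc : checkRLe r fre.re ccr = true)
    (hlow : r ≤ (((⟨0, ccr.cc.A, 0, ccr.cc.B, ccr.cc.C⟩ : WeierstrassCurve ℤ)).map (Int.castRingHom ℚ)).mordellWeilRank) :
    (((⟨0, ccr.cc.A, 0, ccr.cc.B, ccr.cc.C⟩ : WeierstrassCurve ℤ)).map (Int.castRingHom ℚ)).mordellWeilRank = r := by
  haveI : Fact (Irreducible (MonicCubic.polyQ fre.re.core.a fre.re.core.b fre.re.core.c)) :=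
    ⟨fre.re.core.irreducible_of_reg (fre.toE.checkReg_of_coreE (fre.checkCoreE_of_checkRE hE))⟩
  exact rank_eq_of_checkRLe_RE (K := CubicField fre.re.core.a fre.re.core.b fre.re.core.c) r fre
    (CubicField.aeval_root _ _ _) (CubicField.finrank_eq _ _ _) hE hpr ccr hc hlow

/-- **`rank E(ℚ) = r` for the ORIGINAL model** `(a₁, a₂, a₃, a₄, a₆)` when the records certify its completed-square
model rescaled by `d`. [cite: CremonaAlgorithms1997, §3.6] [cite: SilvermanAEC2009, III.3.1(b)] -/
theorem rank_eq_of_certsRELe_scaled (r : ℕ) (fre : ClFieldCertRE) (ccr : ClCurveCertR) (hE : fre.checkRE = true)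
    (hpr : fre.toE.primeListE.Forall Nat.Prime) (hc : checkRLe r fre.re ccr = true) (a₁ a₂ a₃ a₄ a₆ d : ℤ) (hd : d ≠ 0)
    (hABC : ccr.cc.A = d ^ 2 * (a₁ ^ 2 + 4 * a₂) ∧ ccr.cc.B = d ^ 4 * (8 * (a₁ * a₃ + 2 * a₄)) ∧
      ccr.cc.C = d ^ 6 * (16 * (a₃ ^ 2 + 4 * a₆)))
    (hlow : r ≤ (((⟨a₁, a₂, a₃, a₄, a₆⟩ : WeierstrassCurve ℤ)).map (Int.castRingHom ℚ)).mordellWeilRank) :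
    (((⟨a₁, a₂, a₃, a₄, a₆⟩ : WeierstrassCurve ℤ)).map (Int.castRingHom ℚ)).mordellWeilRank = r := by
  obtain ⟨hA, hB, hC⟩ := hABC
  have hV : ((⟨0, a₁ ^ 2 + 4 * a₂, 0, 8 * (a₁ * a₃ + 2 * a₄), 16 * (a₃ ^ 2 + 4 * a₆)⟩ : WeierstrassCurve ℤ)).map
        (Int.castRingHom ℚ) =
      (⟨Units.mk0 (1 / 2 : ℚ) (by norm_num), 0, -(a₁ : ℚ) / 2, -(a₃ : ℚ) / 2⟩ :
        WeierstrassCurve.VariableChange ℚ) •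
        (((⟨a₁, a₂, a₃, a₄, a₆⟩ : WeierstrassCurve ℤ)).map (Int.castRingHom ℚ)) := by
    ext <;> simp only [WeierstrassCurve.map_a₁, WeierstrassCurve.map_a₂, WeierstrassCurve.map_a₃, WeierstrassCurve.map_a₄, WeierstrassCurve.map_a₆,
      WeierstrassCurve.variableChange_a₁, WeierstrassCurve.variableChange_a₂, WeierstrassCurve.variableChange_a₃, WeierstrassCurve.variableChange_a₄,
      WeierstrassCurve.variableChange_a₆, Units.val_inv_eq_inv_val, Units.val_mk0, eq_intCast, Int.cast_zero] <;> push_cast <;> ring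
  have hr₁ : (((⟨0, a₁ ^ 2 + 4 * a₂, 0, 8 * (a₁ * a₃ + 2 * a₄), 16 * (a₃ ^ 2 + 4 * a₆)⟩ : WeierstrassCurve ℤ)).map
        (Int.castRingHom ℚ)).mordellWeilRank =
      (((⟨a₁, a₂, a₃, a₄, a₆⟩ : WeierstrassCurve ℤ)).map (Int.castRingHom ℚ)).mordellWeilRank := by
    rw [hV]; exact WeierstrassCurve.mordellWeilRank_variableChange_holds _ _
  have hS : scaleModel (⟨0, a₁ ^ 2 + 4 * a₂, 0, 8 * (a₁ * a₃ + 2 * a₄), 16 * (a₃ ^ 2 + 4 * a₆)⟩ :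
      WeierstrassCurve ℤ) d = ⟨0, ccr.cc.A, 0, ccr.cc.B, ccr.cc.C⟩ := by
    simp only [scaleModel, hA, hB, hC, mul_zero]
  have hr₂ := mordellWeilRank_scaleModel
    (⟨0, a₁ ^ 2 + 4 * a₂, 0, 8 * (a₁ * a₃ + 2 * a₄), 16 * (a₃ ^ 2 + 4 * a₆)⟩ : WeierstrassCurve ℤ) hd
  rw [hS] at hr₂
  rw [← hr₁, ← hr₂] at hlow ⊢
  exact rank_eq_of_certsRELe r fre ccr hE hpr hc hlow

/-- The plain completed-square shape (`d = 1`). [cite: CremonaAlgorithms1997, §3.6] -/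
theorem rank_eq_of_certsRELe_complSq (r : ℕ) (fre : ClFieldCertRE) (ccr : ClCurveCertR) (hE : fre.checkRE = true)
    (hpr : fre.toE.primeListE.Forall Nat.Prime) (hc : checkRLe r fre.re ccr = true) (a₁ a₂ a₃ a₄ a₆ : ℤ)
    (hABC : ccr.cc.A = a₁ ^ 2 + 4 * a₂ ∧ ccr.cc.B = 8 * (a₁ * a₃ + 2 * a₄) ∧ ccr.cc.C = 16 * (a₃ ^ 2 + 4 * a₆))
    (hlow : r ≤ (((⟨a₁, a₂, a₃, a₄, a₆⟩ : WeierstrassCurve ℤ)).map (Int.castRingHom ℚ)).mordellWeilRank) :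
    (((⟨a₁, a₂, a₃, a₄, a₆⟩ : WeierstrassCurve ℤ)).map (Int.castRingHom ℚ)).mordellWeilRank = r :=
  rank_eq_of_certsRELe_scaled r fre ccr hE hpr hc a₁ a₂ a₃ a₄ a₆ 1 one_ne_zero
    (by obtain ⟨hA, hB, hC⟩ := hABC; exact ⟨by rw [hA]; ring, by rw [hB]; ring, by rw [hC]; ring⟩) hlow

end Summit.BirchSwinnertonDyer.BirchSwinnertonDyer.Rank2Observatory.TwoDescCl

end
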